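import Summits.AnomalousDissipation.AnomalousDissipation.Theorems.WindLineWindyGalerkinSteadyZerothLawGenericLeafNondegeneracyOpen
import Summits.AnomalousDissipation.AnomalousDissipation.Theorems.WindLineWindyGalerkinSteadyZerothLawGenericLeafNondegeneracyDense

/-!
# Stub `stub_genericLeafNondegeneracy` (B) of crux `WindLine.WindyGalerkinSteadyZerothLaw`
# (stmt-AnomalousDissipation-11414), line `registered`: GENERIC LEAF-NONDEGENERACY OF STEADY STATES

Registered signature (proved here, textually), in
`namespace Summit.AnomalousDissipation.AnomalousDissipation.Theorems.WindLineWindyGalerkinSteadyZerothLaw`: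
for every viscosity `ν > 0` and momentum `m ∈ ℝ³`, the admissible parameters `c ∈ 𝒜` (conjugation-
symmetric square-summable families with no mean mode and transversal coefficients; force
`F⟦c⟧ = SymL2.field (k ↦ e^{|k|²}) c`) such that EVERY classical steady state `(u, p)` of `NS_ν(F⟦c⟧)`
with `∫ u = m` is leaf-nondegenerate (`¬ IsLinNSEigenvalue ν u 0`) contain an open dense subset of `𝒜`:
`Dense (interior {c | …})`.

This is Foias–Temam's generic regularity of the steady solution set (LNM 565 (1976) Thm. 1 and p. 26;
CPAM 30 (1977); Ann. SNS Pisa 5 (1978) Thm. 3.1–3.2), at fixed momentum in the leaf, pulled back to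
`𝒜`.  The set is OPEN (`GenericLeaf.isOpen_leafNondegenerate`, file `…GenericLeafNondegeneracyOpen.lean`:
properness of the drifted steady lattice map + openness of invertibility of the lattice
linearisation) and DENSE (`GenericLeaf.dense_leafNondegenerate`, file `…GenericLeafNondegeneracyDense.lean`:
compact solution sets, Fredholm index zero of `4π²ν + compact`, uniform finite-mode transversality,
finite-mode slices of `𝒜`, the index count and the finite-dimensional Smale–Sard step), so its interior
is itself and is dense.  Tool files: `…GenericLeafNondegeneracyTools{,B,C,D,E,F,G,H,I,J,K,L}.lean`.

References: FoiasTemam1976, FoiasTemam1977, FoiasTemam1978, SautTemam1979, Smale1965, Temam1979 Ch. II §1.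
-/

noncomputable section

-- D-0017: single-problem summit ⇒ the duplicated namespace segment is by design.
set_option linter.dupNamespace false

open scoped InnerProductSpace Topology ComplexConjugate
open MeasureTheory Filter UnitAddTorus Set
open Literature.Analysis.FunctionSpaces Literature.Analysis.FunctionSpaces.Torus
open Literature.Analysis.FunctionSpaces.EuclideanSpace
open Literature.Analysis.FluidPDE Literature.Analysis.FluidPDE.Torus

namespace Summit.AnomalousDissipation.AnomalousDissipation.Theorems.WindLineWindyGalerkinSteadyZerothLaw

/-- The flat three-torus (local notation). -/
local notation "𝕋³" => UnitAddTorus (Fin 3)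
/-- Velocity values (local notation). -/
local notation "E³" => EuclideanSpace ℝ (Fin 3)
set_option quotPrecheck false in
/-- admissible parameters -/
local notation "𝒜" => ({c : SymL2 (Fin 3) | c 0 = 0 ∧
  ∀ k : Fin 3 → ℤ, ∑ j : Fin 3, ((k j : ℤ) : ℂ) * c k j = 0} : Set (SymL2 (Fin 3)))
/-- the force of a parameter -/
local notation "F⟦" c "⟧" => SymL2.field (fun k : Fin 3 → ℤ => Real.exp (freqNormSq k)) (c : SymL2 (Fin 3))

/-- **Registered stub B — `stub_genericLeafNondegeneracy` (generic leaf-nondegeneracy of steady states;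
Foias–Temam 1976/1977/1978, Saut–Temam 1979).**  For every `ν > 0` and every momentum `m`, the
admissible parameters `c` such that EVERY classical steady state `(u, p)` of `NS_ν(F⟦c⟧)` with
`∫ u = m` has a linearisation without kernel in the mean-zero class contain an open dense subset of
`𝒜`: the set is open (`GenericLeaf.isOpen_leafNondegenerate`) and dense
(`GenericLeaf.dense_leafNondegenerate`). -/
theorem stub_genericLeafNondegeneracy :
    ∀ (ν : ℝ) (m : E³), 0 < ν →
      Dense (interior {c : 𝒜 | ∀ (u : 𝕋³ → E³) (p : 𝕋³ → ℝ),
        IsSteadyNSState ν F⟦c⟧ u p → ∫ x, u x = m → ¬ IsLinNSEigenvalue ν u 0}) := by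
  intro ν m hν
  rw [(GenericLeaf.isOpen_leafNondegenerate ν m hν).interior_eq]
  exact GenericLeaf.dense_leafNondegenerate ν m hν

end Summit.AnomalousDissipation.AnomalousDissipation.Theorems.WindLineWindyGalerkinSteadyZerothLaw

end
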